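import Summits.HodgeConjecture.HodgeConjecture.Theorems.R90S6OrbitNcardCoverGlue      -- ★ glue `orbit_mem_of_ncard_eq_of_cover_of_injective`
import Summits.HodgeConjecture.HodgeConjecture.Theorems.R90S6CartanExhaustionU3       -- ★ W8-a `exists_mem_orbit_torusGen_pow_three`
import Summits.HodgeConjecture.HodgeConjecture.Theorems.R90S6CartanShellSphere        -- ★ W7-i `ncard_orbit_one_eq_one`
import Summits.HodgeConjecture.HodgeConjecture.Theorems.R90S6ShellIndexU3             -- ★ W8-b `ncard_orbit_torusGen_pow_three`
import HarnessLib

/-!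
# R90 · S6 «Ch. 14.1–14.5 stable trace formula» — WAVE 8 card W8-c: THE PAYER `hsep` AT `N = 3`
# (`Theorems/R90S6IndexSeparatesU3.lean`; the index `#(K₀ g K₀ ∕ K₀)` separates the `K₀`-double cosets of `U(σ, J₀)(K)`)

Cell `hodgecm-mathlib`, crux H413 (`stmt-HodgeConjecture-24833`), route of record `HCCMUnconditional`; programme R90-TF, section S6
(base `R90-C14`), seat R90-C14-p06 (g0); S6 DEAL «WAVE 8 + W7-h + TOKENS» (R90-C14-plan (g2), R90 bus 2026-09-04T23:34:54Z: «W8-c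
`mem_orbit_of_ncard_orbit_eq_three` (THE PAYER `hsep` N = 3) → p06 (g0) → `Theorems/R90S6IndexSeparatesU3.lean` = glue + W8-a ★ + W8-b ★ +
strict monotonicity»).  Statement VERBATIM from the typist's sheet `R90/R90-C14-typ2/g2/S6_wave8_targets.v1.b05122f413d1b42e.lean` :77–:87
(AUDIT BOX S6#W8 CLEAN ×5, R90 bus 23:37:31Z; namespace `…R90.S6`, the sheet's `.Wave8` dropped).  Helper lane
`--supports stmt-HodgeConjecture-24833 --as helper`; THEOREMS ONLY (no definition, no instance, no notation, no named fact, no `sorry`); imports =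
the four ★ S6 Theorems modules named above + HarnessLib (no Lines import).

CONTENT.  `U = U(σ, J₀)(K)`, `J₀ = antidiag(1,1,1)`, over a discretely valued field `K` with an unramified local conjugation datum `hd`
(`t = hd.torusGen = diag(ϖ, 1, ϖ⁻¹)`), `K₀ = unitaryInt` hyperspecial, residual binders `hσO σk hσk hk hfrob` (`|𝓀| = q²`, Frobenius `y ↦ y^q`).
The Cartan shells `K₀ tᵐ K₀` COVER `U` (★ W8-a, Bruhat–Tits (4.4.3)); their indices are `1` (`m = 0`, ★ `ncard_orbit_one_eq_one`) and
`(q³+1)·q^{4m−3}` (`m ≥ 1`, ★ W8-b, Bruhat–Tits (4.4.4) via the lattice tree), a STRICTLY INCREASING function of `m` since `q ≥ 2`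
(`q² = |𝓀| > 1`, the residue field being a field): `1 < (q³+1)·q` and `(q³+1)·q^{4m−3} < (q³+1)·q^{4m+1}`.  Hence the indices are pairwise
distinct and the ★ glue `orbit_mem_of_ncard_eq_of_cover_of_injective` gives: equal index ⇒ same double coset — the letter `hsep` of ★ W7-a.3
`mk_mulEquiv_mem_orbit_of_ncard_separates` ∕ ★ W7-a.4 `coeff_toVector_comp_eq_of_memLaw` («eG-independence») at `(U(J₀,3)(K), K₀)`, abstract `K`
(the inert-place instance with the letters of `galAdicCompletionMap` is W8-c′, `Theorems/R90S6IndexSeparatesU3Inert.lean`).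

* **`mem_orbit_of_ncard_orbit_eq_three`** — W8-c.

HONEST LABEL: a helper theorem, count-neutral until the E1.3.9 assembly consumes it through W7-a.4; HC_CM is proved only modulo the 7 printed
citations (2 remaining named inputs: hLiu418 = stmt-HodgeConjecture-24832, h413 = stmt-HodgeConjecture-24833) until rung 0 closes; REL ≠ ★ ≠ BUILT.

## References
* [BruhatTits1972] F. Bruhat, J. Tits, *Groupes réductifs sur un corps local I*, Publ. IHÉS 41 (1972), (4.4.3) (Cartan decomposition),
  (4.4.4) (indices of the shells).
* [Tits1979] J. Tits, *Reductive groups over local fields*, PSPM 33.1 (1979), §2.4, §3.3.3.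
-/

set_option autoImplicit false
-- the mandated namespace repeats the single-problem summit's segment (`HodgeConjecture.HodgeConjecture`)
set_option linter.dupNamespace false

noncomputable section

open scoped Valued WithZero Matrix MatrixGroups

open Literature.NumberTheory.Automorphic Literature.NumberTheory.Automorphic.HermitianLattice
  Literature.NumberTheory.Automorphic.UnitaryLatticeTree Literature.NumberTheory.Automorphic.CartanUnique
  Literature.NumberTheory.Automorphic.SymplecticCartan

namespace Summit.HodgeConjecture.HodgeConjecture.R90.S6

variable {K : Type*} [Field K] [Valued K ℤᵐ⁰] {σ : K →+* K} {ϖ : K}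

/-- **W8-c THE PAYER `hsep` AT `N = 3`**: the index `#(K₀ g K₀ ∕ K₀)` SEPARATES the `K₀`-double cosets of `U(σ, J₀)(K)` — in the letters of
W7-a.3 (`mk_mulEquiv_mem_orbit_of_ncard_separates`).  The glue `orbit_mem_of_ncard_eq_of_cover_of_injective` at the Cartan shells `m ↦ tᵐ`:
they cover `U` (★ W8-a `exists_mem_orbit_torusGen_pow_three`) and their indices `1, (q³+1)q, (q³+1)q⁵, …` (★ `ncard_orbit_one_eq_one`,
★ W8-b `ncard_orbit_torusGen_pow_three`) are strictly increasing in `m` (`q ≥ 2` since `q² = |𝓀| > 1`), hence pairwise distinct.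
[cite: BruhatTits1972, (4.4.3), (4.4.4)] [cite: Tits1979, §2.4, §3.3.3] -/
theorem mem_orbit_of_ncard_orbit_eq_three (hd : UnramifiedLocalConjDatum σ ϖ) (hσO : ∀ x : 𝒪[K], σ x ∈ 𝒪[K]) (σk : 𝓀[K] →+* 𝓀[K])
    (hσk : ∀ x : 𝒪[K], IsLocalRing.residue 𝒪[K] ⟨σ x, hσO x⟩ = σk (IsLocalRing.residue 𝒪[K] x))
    [Fintype 𝓀[K]] {q : ℕ} (hk : Fintype.card 𝓀[K] = q ^ 2) (hfrob : ∀ y, σk y = y ^ q)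
    (g g' : unitaryGroupOfForm σ ((StdForm.antidiagonal 3).over K))
    (h : (MulAction.orbit (unitaryInt σ ((StdForm.antidiagonal 3).over K))
          (g : unitaryGroupOfForm σ ((StdForm.antidiagonal 3).over K) ⧸ unitaryInt σ ((StdForm.antidiagonal 3).over K))).ncard =
        (MulAction.orbit (unitaryInt σ ((StdForm.antidiagonal 3).over K))
          (g' : unitaryGroupOfForm σ ((StdForm.antidiagonal 3).over K) ⧸ unitaryInt σ ((StdForm.antidiagonal 3).over K))).ncard) :
    (g' : unitaryGroupOfForm σ ((StdForm.antidiagonal 3).over K) ⧸ unitaryInt σ ((StdForm.antidiagonal 3).over K)) ∈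
      MulAction.orbit (unitaryInt σ ((StdForm.antidiagonal 3).over K))
        (g : unitaryGroupOfForm σ ((StdForm.antidiagonal 3).over K) ⧸ unitaryInt σ ((StdForm.antidiagonal 3).over K)) := by
  -- `q ≥ 2`: the residue field `𝓀` is a field, so `1 < |𝓀| = q²`
  have hq : 1 < q := (Nat.one_lt_pow_iff two_ne_zero).1 (hk ▸ Fintype.one_lt_card)
  refine orbit_mem_of_ncard_eq_of_cover_of_injective (unitaryInt σ ((StdForm.antidiagonal 3).over K))
    (fun m : ℕ => hd.torusGen ^ m) (fun u => exists_mem_orbit_torusGen_pow_three hd u) ?_ h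
  -- the shell indices `1, (q³+1)q, (q³+1)q⁵, …` are strictly increasing in `m`, hence pairwise distinct
  refine StrictMono.injective (strictMono_nat_of_lt_succ fun n => ?_)
  rcases Nat.eq_zero_or_pos n with rfl | hn
  · -- `#(K₀ 1 K₀ ∕ K₀) = 1 < (q³+1)·q = #(K₀ t K₀ ∕ K₀)`
    rw [pow_zero, ncard_orbit_one_eq_one σ, zero_add, ncard_orbit_torusGen_pow_three hd hσO σk hσk hk hfrob le_rfl,
      show 4 * 1 - 3 = 1 by norm_num, pow_one]
    exact lt_of_lt_of_le hq (Nat.le_mul_of_pos_left q (Nat.succ_pos _))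
  · -- `(q³+1)·q^{4n−3} < (q³+1)·q^{4(n+1)−3}`
    rw [ncard_orbit_torusGen_pow_three hd hσO σk hσk hk hfrob hn,
      ncard_orbit_torusGen_pow_three hd hσO σk hσk hk hfrob (Nat.le_add_left 1 n)]
    exact (Nat.mul_lt_mul_left (Nat.succ_pos _)).2 (Nat.pow_lt_pow_right hq (by omega))

end Summit.HodgeConjecture.HodgeConjecture.R90.S6

end
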